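import Summits.QuantumFields.YangMills.Theses.EquipartitionCriticality
import Literature.MathematicalPhysics.QuantumFieldTheory.YangMillsOS
import Literature.MathematicalPhysics.QuantumLattice.WilsonBlockHeatBathSemigroup
import Literature.MathematicalPhysics.QuantumLattice.WilsonBlockHeatBathLightCone2
import Summits.QuantumFields.YangMills.Theorems.EquipartitionCriticalityLatticeGapLargeBetaStubBetaAbsorption
import Summits.QuantumFields.YangMills.Theorems.EquipartitionCriticalityLatticeGapLargeBetaStubLipschitzKernelVersion
import Summits.QuantumFields.YangMills.Theorems.EquipartitionCriticalityLatticeGapLargeBetaStubSpeciesClustering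

/-!
# Line `Sketch` (one-form Witten operator / Helffer–Sjöstrand + IMS + Combes–Thomas) — checked skeleton
for crux stmt-QuantumFields-8761
(`Summit.QuantumFields.YangMills.Theses.EquipartitionCriticality.LatticeGapLargeBeta` ≡
`…DirichletWindow.LatticeGapLargeBeta`: volume-uniform exponential time-clustering of all bounded
gauge-invariant local observables on the tori `(2S+1)⁴` at every large `β`, `β`-uniform `C(A,B)`).

LEAD `prover-line-stmt-QuantumFields-8761-0` (opening lead, gen 1, 2026-08-16).  The only line handed over
(`payload.lines = [Sketch]`, the crux-ideate card `one-form-witten-ims` and its `Sketch.lean`; the evidence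
file itself is not mounted in this jail) is OWNED here in the reshaped form below.

## The card's chain and what is typed

Card: crux ⇐ (measurable / β-uniform upgrade) ⇐ EC for smooth cylinder observables with constants
`(2/σ)‖∇F‖‖∇G‖e^{-μ·dist}` ⇐ (Helffer–Sjöstrand identity `Cov(F,G) = ⟨∇F,(A¹)⁻¹∇G⟩` + Combes–Thomas for
the link-banded Witten 1-form operator `A¹ ≥ σ(β)`) ⇐ C⁺ `OneFormGap` ⇐ (IMS localisation in the link index)
⇐ C⁺⁺ `OneBlockBottom`.

The operator `A¹` on left-trivialised 1-forms of `G^{E_S}` (Weitzenböck form, second derivatives along the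
Lie algebra of `r(G)`) has no junk-free spelling over the tree today (it needs a reviewed Defs layer:
`𝔤_r`, left-invariant frames for a general `LatticeRep`, `L²` 1-forms, the Friedrichs form of `A¹`).  The
skeleton therefore registers as its HEART the OUTPUT of HS + Combes–Thomas at level C⁺ — per-`β`
exponential decay of covariances of LIPSCHITZ cylinder functions on all large tori, constants of product
form `K(β)·K_f·K_g·|Λ_f|·|Λ_g|` (metric Lipschitz constants in each link w.r.t. the Frobenius distance through
`r.ρ`, no differential structure needed) — and files the two upgrades the card calls "shared debt of every
functional-inequality line" plus the `β`-absorption as three provable stubs: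

  H  `stub_lipschitzCovarianceDecay`  [OPEN — the heart, held by the lead] large-`β` Lipschitz-cylinder
     covariance decay in the cyclic time separation, per-`β` constants.  Intended proof = the card
     (finite-dimensional cores `LinkIMSLowerBound`, `CombesThomasBanded` are landed as `--supports` helpers).
  P1 `stub_lipschitzKernelVersion`    [L, LANDED p105397] one heat-bath step regularises: the DLR kernel of the
     plaquette potential is a version of `E_μ[f | links off Λ]` reading only the collar `T`, bounded by the
     same constant, and LIPSCHITZ in every link with constant `c(β,r)·‖f‖_∞`, `c` uniform in `S, Λ`.
  P2 `stub_speciesClustering`         [L, LANDED p106071] P1 + H at every `β ≥ β₁` ⇒ per-`β` clustering of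
     `latticeConnectedCorr` for all `YMSpecies` with a `β`-INDEPENDENT observable weight `D(A,B)` and a
     `β`-dependent prefactor `K(β)` (pull-out of conditional expectations on both observables, torus
     bookkeeping of the shifted periodic supports, a priori bound at small `n` / small `S`, rate `min μ 1`).
  P3 `stub_betaAbsorption`            [S, LANDED p102257] `K(β)·D(A,B)·e^{-m n}` with the a priori bound
     `2‖A‖‖B‖` ⇒ the crux's `β`-uniform `C(A,B)` with rate `m(β)/max(1, log K')` (real analysis).
Composition (sorry-free): `LatticeGapLargeBeta_of` proves the crux BY NAME from H, P1, P2, P3.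

Alternative transfer recorded (not used): an `L²` slab-decay heart composes with the LANDED
`Summit.QuantumFields.YangMills.Theorems.LatticeGapInUVUnits.FemtoSlabNondegeneracy.stub_decayToClustering`.

Disproof.lean: none exists for this crux at registration time (`payload.disproof_path` absent from the jail;
`ledger crux ls`: Ideas only).  Crux notes honoured: "FALSE with a U(1) factor" — H carries
`IsCompactSimpleLieGroup G`; "β-uniform C(A,B) is an extra spectral-weight demand" — discharged by P2+P3
(product form + absorption); "bulk first-order points" — `∃ β₁`.
-/

noncomputable section

open scoped BigOperators Topology
open MeasureTheory ProbabilityTheory Filter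
open Literature.MathematicalPhysics.QuantumFieldTheory Literature.MathematicalPhysics.QuantumLattice

namespace Summit.QuantumFields.YangMills.Cruxes.LatticeGapLargeBeta.WittenIMS

/-! ### §1 The four stubs (after wave 1 the ONLY `sorry` of this file is the heart H) -/

/-- `stub_lipschitzKernelVersion` — **one heat-bath step regularises** (P1; provable now, size L).
For the torus Wilson state at `β` (torus `(2S+1)⁴`), a finite link set `Λ` with a collar `T` (disjoint from
`Λ`, containing every edge of every plaquette meeting `Λ` that is not in `Λ`), and a bounded measurable `f`
reading only `Λ`: the DLR kernel `U ↦ ∫ f(V_Λ ⊕ U) e^{-β S_Λ(V_Λ ⊕ U)} dV / Z_Λ(U)` is a version of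
`E_μ[f | links off Λ]` which is measurable, bounded by the same `M`, reads only `T`, and is Lipschitz in
every link: changing `U_e` to `h` moves it by at most `c·M·‖r.ρ h − r.ρ(U_e)‖_F`, with `c = c(β, r)`
uniform in `S`, `Λ`, `T` (only the ≤ 6 plaquettes through `e` enter: `|ΔS_Λ| ≤ 6√N‖Δρ‖_F`, and
`|E_{w'}f − E_w f| ≤ 2M(e^{2β sup|ΔS_Λ|} − 1)`).  Tree: `TorusWilsonGibbs` (DLR kernel of the plaquette
potential), `WilsonBlockHeatBath.exists_local_condExp_version` (locality, same hypotheses `hT`). -/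
theorem stub_lipschitzKernelVersion :
    ∀ (G : Type) [Group G] [TopologicalSpace G] [IsTopologicalGroup G] [CompactSpace G]
      [MeasurableSpace G] [BorelSpace G] (r : LatticeRep G) (β : ℝ),
    ∃ c : ℝ, ∀ (S : ℕ) (Λ T : Finset (Edge 4 (2 * S + 1))), Disjoint Λ T →
      (∀ (y : Site 4 (2 * S + 1)) (i j : Fin 4), i < j →
        (({(y, i), (y.shift i, j), (y.shift j, i), (y, j)} : Finset (Edge 4 (2 * S + 1))) ∩ Λ).Nonempty →
        (↑({(y, i), (y.shift i, j), (y.shift j, i), (y, j)} : Finset (Edge 4 (2 * S + 1))) :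
          Set (Edge 4 (2 * S + 1))) ⊆ ↑Λ ∪ ↑T) →
      ∀ (f : GaugeConfig 4 (2 * S + 1) G → ℝ) (M : ℝ), Measurable f → (∀ U, |f U| ≤ M) →
        DependsOn f (↑Λ : Set (Edge 4 (2 * S + 1))) →
      ∃ f' : GaugeConfig 4 (2 * S + 1) G → ℝ, Measurable f' ∧ (∀ U, |f' U| ≤ M) ∧
        DependsOn f' (↑T : Set (Edge 4 (2 * S + 1))) ∧
        (∀ (U : GaugeConfig 4 (2 * S + 1) G) (e : Edge 4 (2 * S + 1)) (h : G),
          |f' (Function.update U e h) - f' U| ≤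
            c * M * Real.sqrt (∑ a, ∑ b, ‖(r.ρ h - r.ρ (U e)) a b‖ ^ 2)) ∧
        f' =ᵐ[(wilsonMeasure r.ρ β : Measure (GaugeConfig 4 (2 * S + 1) G))]
          (wilsonMeasure r.ρ β : Measure (GaugeConfig 4 (2 * S + 1) G))[f | cylinderEvents ((↑Λ : Set (Edge 4 (2 * S + 1)))ᶜ)] :=
  -- LANDED (wave 1, p105397): Theorems/EquipartitionCriticalityLatticeGapLargeBetaStubLipschitzKernelVersion.lean
  _root_.Summit.QuantumFields.YangMills.Theorems.LatticeGapLargeBeta.WittenIMS.stub_lipschitzKernelVersion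

/-- `stub_lipschitzCovarianceDecay` — **THE HEART (C⁺-level output of the card; OPEN; held by the lead)**:
for every compact simple `G` and faithful `r` there is `β₁` such that at every `β ≥ β₁` the torus Wilson
states cluster exponentially IN THE CYCLIC TIME SEPARATION for Lipschitz cylinder functions, uniformly in
the volume: some `μ(β) > 0`, `K(β)`, `S₀(β)` such that on every torus `S ≥ S₀(β)`, for bounded measurable
`f, g` reading the link sets `Λ_f, Λ_g` and Lipschitz in every link (constants `K_f, K_g` w.r.t. the
Frobenius distance through `r.ρ`), whenever every pair of links of `Λ_f × Λ_g` is at cyclic time separation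
`≥ k` (both `ZMod` differences have `val ≥ k`),
`|∫ f g − ∫ f ∫ g| ≤ K(β) K_f K_g |Λ_f| |Λ_g| e^{−μ(β) k}`.
Intended proof (card `one-form-witten-ims`): Helffer–Sjöstrand `Cov(f,g) = ⟨∇f, (A¹)⁻¹∇g⟩` for the Witten
1-form operator `A¹` of `μ_{β,S}` (banded in the link index), Combes–Thomas (`CombesThomasBanded`) from a
uniform bottom `A¹ ≥ σ(β)` (C⁺, `ker A¹ = H¹(G^E) = 0` uses `b₁(G) = 0`, i.e. SIMPLICITY of `G`), and C⁺ from
ONE block inequality `inf_ζ σ(B_L, ζ; β) ≥ 2 C_IMS β / L²` at one scale `L(β)` via IMS (`LinkIMSLowerBound`).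
Honest knots: adversarial boundary conditions (K-a), co-exact collapse (K-b); the block bottom is the
4-D weak-coupling gap itself at scale `L(β)`. -/
theorem stub_lipschitzCovarianceDecay :
    ∀ (G : Type) [Group G] [TopologicalSpace G] [IsTopologicalGroup G] [CompactSpace G]
      [MeasurableSpace G] [BorelSpace G], IsCompactSimpleLieGroup G → ∀ (r : LatticeRep G),
    ∃ β₁ : ℝ, ∀ β : ℝ, β₁ ≤ β →
      ∃ μ : ℝ, 0 < μ ∧ ∃ K : ℝ, ∃ S₀ : ℕ, ∀ S : ℕ, S₀ ≤ S →
      ∀ (f g : GaugeConfig 4 (2 * S + 1) G → ℝ) (Λf Λg : Finset (Edge 4 (2 * S + 1))) (Kf Kg : ℝ),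
        0 ≤ Kf → 0 ≤ Kg → Measurable f → Measurable g →
        (∃ M : ℝ, ∀ U, |f U| ≤ M) → (∃ M : ℝ, ∀ U, |g U| ≤ M) →
        DependsOn f (↑Λf : Set (Edge 4 (2 * S + 1))) → DependsOn g (↑Λg : Set (Edge 4 (2 * S + 1))) →
        (∀ (U : GaugeConfig 4 (2 * S + 1) G) (e : Edge 4 (2 * S + 1)) (h : G),
          |f (Function.update U e h) - f U| ≤ Kf * Real.sqrt (∑ a, ∑ b, ‖(r.ρ h - r.ρ (U e)) a b‖ ^ 2)) →
        (∀ (U : GaugeConfig 4 (2 * S + 1) G) (e : Edge 4 (2 * S + 1)) (h : G),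
          |g (Function.update U e h) - g U| ≤ Kg * Real.sqrt (∑ a, ∑ b, ‖(r.ρ h - r.ρ (U e)) a b‖ ^ 2)) →
      ∀ k : ℕ, (∀ e ∈ Λf, ∀ e' ∈ Λg, k ≤ (e.1 0 - e'.1 0).val ∧ k ≤ (e'.1 0 - e.1 0).val) →
        |(∫ U, f U * g U ∂(wilsonMeasure r.ρ β : Measure (GaugeConfig 4 (2 * S + 1) G))) -
            (∫ U, f U ∂(wilsonMeasure r.ρ β : Measure (GaugeConfig 4 (2 * S + 1) G))) *
              ∫ U, g U ∂(wilsonMeasure r.ρ β : Measure (GaugeConfig 4 (2 * S + 1) G))| ≤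
          K * Kf * Kg * Λf.card * Λg.card * Real.exp (-(μ * k)) := by
  sorry

/-- `stub_speciesClustering` — **from Lipschitz covariance decay to per-β clustering of all species with a
β-independent observable weight** (P2; provable now, size L).  If at every `β ≥ β₁` one heat-bath step
regularises with constant `c(β)` (P1) and Lipschitz cylinder functions cluster in the cyclic time
separation with `(μ(β), K(β), S₀(β))` (H), then there are a `β`-INDEPENDENT weight `D(A,B)` and, for every
`β ≥ β₁`, a rate `m(β) > 0`, a prefactor `K'(β)` and a threshold `S₁(β)` with
`|corr_{β,2S+1}(A,B,n)| ≤ K'(β) D(A,B) e^{−m(β) n}` for all species `A, B`, `S ≥ S₁(β)`, `n ≤ S`.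
Proof: write the correlation through the shifted periodic lifts (`latticeConnectedCorr_eq_integral_sub`,
`shiftedObservable_props`); replace `f = A.F ∘ lift` and `τ_n g` by their P1-versions `f̃, g̃` on the collars
`T_A, T_B` (pull-out, `Measurable.measurable_cylinderEvents_of_dependsOn`, valid once the collars and
supports are time-disjoint, i.e. `n ≥ w_A + w_B + 4`, `w` = time extent of the support); apply H with
`K_f = c C_A`, `K_g = c C_B`, cyclic separation `k = n − w_A − w_B − 4` (the other way round the cycle is
longer since `n ≤ S`); use the rate `m = min μ 1` so that `e^{m(w_A+w_B+4)} ≤ e^{w_A+w_B+4}` is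
`β`-independent; small `n` and small `S` (supports wrapping) by the a priori bound
`abs_latticeConnectedCorr_le_two_mul` with the `β`-independent weight `2 C_A C_B e^{S(A,B)}`. -/
theorem stub_speciesClustering :
    ∀ (G : Type) [Group G] [TopologicalSpace G] [IsTopologicalGroup G] [CompactSpace G]
      [MeasurableSpace G] [BorelSpace G] (r : LatticeRep G) (β₁ : ℝ),
    (∀ β : ℝ, β₁ ≤ β →
      ∃ c : ℝ, ∀ (S : ℕ) (Λ T : Finset (Edge 4 (2 * S + 1))), Disjoint Λ T →
      (∀ (y : Site 4 (2 * S + 1)) (i j : Fin 4), i < j →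
        (({(y, i), (y.shift i, j), (y.shift j, i), (y, j)} : Finset (Edge 4 (2 * S + 1))) ∩ Λ).Nonempty →
        (↑({(y, i), (y.shift i, j), (y.shift j, i), (y, j)} : Finset (Edge 4 (2 * S + 1))) :
          Set (Edge 4 (2 * S + 1))) ⊆ ↑Λ ∪ ↑T) →
      ∀ (f : GaugeConfig 4 (2 * S + 1) G → ℝ) (M : ℝ), Measurable f → (∀ U, |f U| ≤ M) →
        DependsOn f (↑Λ : Set (Edge 4 (2 * S + 1))) →
      ∃ f' : GaugeConfig 4 (2 * S + 1) G → ℝ, Measurable f' ∧ (∀ U, |f' U| ≤ M) ∧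
        DependsOn f' (↑T : Set (Edge 4 (2 * S + 1))) ∧
        (∀ (U : GaugeConfig 4 (2 * S + 1) G) (e : Edge 4 (2 * S + 1)) (h : G),
          |f' (Function.update U e h) - f' U| ≤
            c * M * Real.sqrt (∑ a, ∑ b, ‖(r.ρ h - r.ρ (U e)) a b‖ ^ 2)) ∧
        f' =ᵐ[(wilsonMeasure r.ρ β : Measure (GaugeConfig 4 (2 * S + 1) G))]
          (wilsonMeasure r.ρ β : Measure (GaugeConfig 4 (2 * S + 1) G))[f | cylinderEvents ((↑Λ : Set (Edge 4 (2 * S + 1)))ᶜ)]) →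
    (∀ β : ℝ, β₁ ≤ β →
      ∃ μ : ℝ, 0 < μ ∧ ∃ K : ℝ, ∃ S₀ : ℕ, ∀ S : ℕ, S₀ ≤ S →
      ∀ (f g : GaugeConfig 4 (2 * S + 1) G → ℝ) (Λf Λg : Finset (Edge 4 (2 * S + 1))) (Kf Kg : ℝ),
        0 ≤ Kf → 0 ≤ Kg → Measurable f → Measurable g →
        (∃ M : ℝ, ∀ U, |f U| ≤ M) → (∃ M : ℝ, ∀ U, |g U| ≤ M) →
        DependsOn f (↑Λf : Set (Edge 4 (2 * S + 1))) → DependsOn g (↑Λg : Set (Edge 4 (2 * S + 1))) →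
        (∀ (U : GaugeConfig 4 (2 * S + 1) G) (e : Edge 4 (2 * S + 1)) (h : G),
          |f (Function.update U e h) - f U| ≤ Kf * Real.sqrt (∑ a, ∑ b, ‖(r.ρ h - r.ρ (U e)) a b‖ ^ 2)) →
        (∀ (U : GaugeConfig 4 (2 * S + 1) G) (e : Edge 4 (2 * S + 1)) (h : G),
          |g (Function.update U e h) - g U| ≤ Kg * Real.sqrt (∑ a, ∑ b, ‖(r.ρ h - r.ρ (U e)) a b‖ ^ 2)) →
      ∀ k : ℕ, (∀ e ∈ Λf, ∀ e' ∈ Λg, k ≤ (e.1 0 - e'.1 0).val ∧ k ≤ (e'.1 0 - e.1 0).val) →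
        |(∫ U, f U * g U ∂(wilsonMeasure r.ρ β : Measure (GaugeConfig 4 (2 * S + 1) G))) -
            (∫ U, f U ∂(wilsonMeasure r.ρ β : Measure (GaugeConfig 4 (2 * S + 1) G))) *
              ∫ U, g U ∂(wilsonMeasure r.ρ β : Measure (GaugeConfig 4 (2 * S + 1) G))| ≤
          K * Kf * Kg * Λf.card * Λg.card * Real.exp (-(μ * k))) →
    ∃ D : YMSpecies G → YMSpecies G → ℝ, ∀ β : ℝ, β₁ ≤ β →
      ∃ m : ℝ, 0 < m ∧ ∃ K : ℝ, ∃ S₁ : ℕ, ∀ (A B : YMSpecies G) (S n : ℕ), S₁ ≤ S → n ≤ S →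
        |latticeConnectedCorr r.ρ β (2 * S + 1) A.F B.F n| ≤ K * D A B * Real.exp (-(m * n)) :=
  -- LANDED (wave 1, p106071): Theorems/EquipartitionCriticalityLatticeGapLargeBetaStubSpeciesClustering.lean
  -- (geometry helpers: …StubSpeciesClusteringGeometry.lean, p103466)
  _root_.Summit.QuantumFields.YangMills.Theorems.LatticeGapLargeBeta.WittenIMS.stub_speciesClustering

/-- `stub_betaAbsorption` — **absorbing the β-dependent prefactor into the rate** (P3; provable now,
size S).  Per-`β` clustering `|corr| ≤ K(β) D(A,B) e^{−m(β) n}` with a `β`-independent weight `D`, together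
with the a priori bound `|corr| ≤ 2 C_A C_B` (`abs_latticeConnectedCorr_le_two_mul`), gives the crux's form
with the `β`-UNIFORM constant `C(A,B) = e · max(D(A,B), 2 C_A C_B)` and the rate
`m(β) / max(1, log K″(β))`, `K″ = max(K, 1)`: if `0 ≤ x ≤ D'` and `x ≤ K″ D' e^{−mn}` then
`x ≤ e D' e^{−mn/max(1, log K″)}` (two cases `mn ≤ / > max(1, log K″)`). -/
theorem stub_betaAbsorption :
    ∀ (G : Type) [Group G] [TopologicalSpace G] [IsTopologicalGroup G] [CompactSpace G]
      [MeasurableSpace G] [BorelSpace G] (r : LatticeRep G),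
    (∃ D : YMSpecies G → YMSpecies G → ℝ, ∃ β₁ : ℝ, ∀ β : ℝ, β₁ ≤ β →
      ∃ m : ℝ, 0 < m ∧ ∃ K : ℝ, ∃ S₁ : ℕ, ∀ (A B : YMSpecies G) (S n : ℕ), S₁ ≤ S → n ≤ S →
        |latticeConnectedCorr r.ρ β (2 * S + 1) A.F B.F n| ≤ K * D A B * Real.exp (-(m * n))) →
    ∃ (β₁ : ℝ) (m : ℝ → ℝ) (S₀ : ℝ → ℕ), (∀ β : ℝ, β₁ ≤ β → 0 < m β) ∧
      ∀ A B : YMSpecies G, ∃ C : ℝ, ∀ β : ℝ, β₁ ≤ β → ∀ S n : ℕ, S₀ β ≤ S → n ≤ S →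
        |latticeConnectedCorr r.ρ β (2 * S + 1) A.F B.F n| ≤ C * Real.exp (-(m β * n)) :=
  -- LANDED (wave 1, p102257): Theorems/EquipartitionCriticalityLatticeGapLargeBetaStubBetaAbsorption.lean
  _root_.Summit.QuantumFields.YangMills.Theorems.LatticeGapLargeBeta.WittenIMS.stub_betaAbsorption

/-! ### §2 The composition (sorry-free): the four stubs prove the crux BY NAME -/

/-- **The line closes the crux modulo its stubs.**  H gives `β₁` and, at every `β ≥ β₁`, Lipschitz
covariance decay on all large tori; P1 regularises at every `β`; P2 turns both into per-`β` species
clustering with a `β`-independent weight; P3 absorbs the `β`-dependent prefactor into the rate.  The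
crux's `letI := borel G` binders are instantiated by the stubs' `[MeasurableSpace G] [BorelSpace G]`. -/
theorem LatticeGapLargeBeta_of :
    Summit.QuantumFields.YangMills.Theses.EquipartitionCriticality.LatticeGapLargeBeta := by
  intro G _ _ _ _ hG
  letI : MeasurableSpace G := borel G
  haveI : BorelSpace G := ⟨rfl⟩
  intro r
  obtain ⟨β₁, hH⟩ := stub_lipschitzCovarianceDecay G hG r
  exact stub_betaAbsorption G r ⟨(stub_speciesClustering G r β₁
    (fun β _ => stub_lipschitzKernelVersion G r β) hH).choose, β₁,
    (stub_speciesClustering G r β₁ (fun β _ => stub_lipschitzKernelVersion G r β) hH).choose_spec⟩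

end Summit.QuantumFields.YangMills.Cruxes.LatticeGapLargeBeta.WittenIMS

end
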